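import Mathlib.MeasureTheory.Integral.Lebesgue.Basic
import Mathlib.Topology.Algebra.InfiniteSum.Real
import Mathlib.Topology.Order.MonotoneConvergence
import Mathlib.Data.ENNReal.BigOperators
import Mathlib.Topology.Instances.ENNReal.Lemmas
import HarnessLib

/-!
# From the exact Euler factorisation over finite sets of good places to the infinite Euler product

Topic `NumberTheory/Automorphic`; namespace `Literature.NumberTheory.Automorphic`. Proof file
(theorems only: no definition, no named fact, no instance; pure measure theory in `[0, ∞]`). The last
piece of bookkeeping between the tree's real-point Rankin–Selberg identities and the real-moment
datum of `PairLFunctionPolesEqConjRealMomentsOneFamily` (Arthur–Clozel (1989), Ch. 3 §2, (2.3);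
Jacquet–Shalika (1981), §4; Cogdell (2004), Thm. 2.2 "the integral is Eulerian"):
`RankinSelbergTorusEulerExact` proves, for every **finite** set `F` of good places, the exact
factorisation `(∏_{v ∈ F} T_v(q_v^{-σ})) · ∫_{B(Good) × K} = ∫_{B(Good ∖ F) × K}` of the unfolded
integral, where `B(G)` is the set of torus points that are units at the places of `G`; the Euler
product over *all* good places is the limit `F ↑ Good`. Abstractly:

* `iSup_finsetProd_mul_setLIntegral_eq_lintegral` — if `(∏_{i ∈ F} T i) · ∫_C G dm = ∫_{B_F} G dm`
  for every finite `F`, with `F ↦ B_F` monotone and `⋃_F B_F = univ` (every torus point is a unit at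
  all but finitely many places), then `(⨆_F ∏_{i ∈ F} T i) · ∫_C G dm = ∫ G dm` (monotone convergence,
  Mathlib `setLIntegral_iUnion_of_directed`);
* `iSup_finsetProd_ofReal_eq_ofReal_tprod` — for a real family `1 ≤ L i` with convergent product
  (Jacquet–Shalika's (2.1), `JacquetShalika1981_multipliable_partialPairL_holds`),
  `⨆_F ∏_{i ∈ F} ofReal (L i) = ofReal (∏' i, L i)`;
* `ofReal_tprod_mul_setLIntegral_eq_lintegral`, `lintegral_toReal_eq_tprod_mul` — hence
  `ofReal (∏' L) · ∫_C G = ∫ G` and, when `∫ G < ∞`, `(∫ G).toReal = (∏' L) · (∫_C G).toReal`: the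
  shape `Ψ(σ) = L^{S₀}(σ) · A(σ)` with `A(σ) = ∫_{B(Good) × K}` the bad-place moment consumed by
  `JacquetShalika1981_partialPairL_pole_of_eq_conj_of_real_moment_datum`.

## References

* H. Jacquet, J. A. Shalika, *On Euler products and the classification of automorphic
  representations I*, Amer. J. Math. 103 (1981), §4, Thm. (5.3) [JacquetShalikaAJM1981].
* J. W. Cogdell, *Analytic theory of L-functions for GL_n*, in *An Introduction to the Langlands
  Program* (2004), §2.3, Thm. 2.2 [CogdellAnalyticTheory2004].
-/

noncomputable section

open scoped ENNReal Topology
open MeasureTheory Filter Set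

namespace Literature.NumberTheory.Automorphic

section EulerLimit

variable {X : Type*} [MeasurableSpace X] {m : Measure X} {ι : Type*}

/-- **Monotone convergence along finite sets of places.** If for every finite `F` the identity
`(∏_{i ∈ F} T i) · ∫_C G dm = ∫_{B_F} G dm` holds, with `F ↦ B_F` monotone and `⋃_F B_F` the whole
space, then `(⨆_F ∏_{i ∈ F} T i) · ∫_C G dm = ∫ G dm` (all in `[0, ∞]`). With `T i = T_v(q_v^{-σ})` the
unramified torus sums, `C = B(Good) × K` and `B_F = B(Good ∖ F) × K` this turns the exact Euler
factorisation over finite `F` (`RankinSelbergTorusEulerExact`) into the factorisation of the full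
unfolded integral `Ψ(σ)` (Jacquet–Shalika (1981), §4; Cogdell (2004), Thm. 2.2). [folklore] -/
theorem iSup_finsetProd_mul_setLIntegral_eq_lintegral [Countable ι] (T : ι → ℝ≥0∞) {G : X → ℝ≥0∞}
    {C : Set X} {B : Finset ι → Set X} (hB : Monotone B) (hBU : (⋃ F, B F) = univ)
    (h : ∀ F : Finset ι, (∏ i ∈ F, T i) * ∫⁻ x in C, G x ∂m = ∫⁻ x in B F, G x ∂m) :
    (⨆ F : Finset ι, ∏ i ∈ F, T i) * ∫⁻ x in C, G x ∂m = ∫⁻ x, G x ∂m := by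
  have hd : Directed (· ⊆ ·) B := hB.directed_le
  rw [ENNReal.iSup_mul, iSup_congr h, ← setLIntegral_iUnion_of_directed G hd, hBU, setLIntegral_univ]

/-- **Finite partial Euler products of real factors `≥ 1` increase to the infinite product**, read in
`[0, ∞]`: for `1 ≤ L i` with `∏ L` convergent, `⨆_F ∏_{i ∈ F} ofReal (L i) = ofReal (∏' i, L i)`
(the net of partial products is monotone and tends to the product; `tendsto_atTop_iSup`). [folklore] -/
theorem iSup_finsetProd_ofReal_eq_ofReal_tprod {L : ι → ℝ} (h1 : ∀ i, 1 ≤ L i) (hL : Multipliable L) :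
    (⨆ F : Finset ι, ∏ i ∈ F, ENNReal.ofReal (L i)) = ENNReal.ofReal (∏' i, L i) := by
  classical
  have hmono : Monotone fun F : Finset ι => ∏ i ∈ F, ENNReal.ofReal (L i) :=
    fun F F' hFF' => Finset.prod_le_prod_of_subset_of_one_le' hFF' fun i _ _ =>
      ENNReal.one_le_ofReal.2 (h1 i)
  have ht : Tendsto (fun F : Finset ι => ∏ i ∈ F, ENNReal.ofReal (L i)) atTop
      (𝓝 (ENNReal.ofReal (∏' i, L i))) := by
    have h' := (ENNReal.continuous_ofReal.tendsto _).comp hL.hasProd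
    refine h'.congr fun F => ?_
    simp only [Function.comp_apply]
    exact ENNReal.ofReal_prod_of_nonneg fun i _ => zero_le_one.trans (h1 i)
  exact tendsto_nhds_unique (tendsto_atTop_iSup hmono) ht

/-- **`Ψ = L^{S₀} · A` in `[0, ∞]`.** If `(∏_{i ∈ F} ofReal (L i)) · ∫_C G dm = ∫_{B_F} G dm` for
every finite `F` (`1 ≤ L i`, `∏ L` convergent, `B` monotone with union the whole space), then
`ofReal (∏' i, L i) · ∫_C G dm = ∫ G dm`. [folklore] -/
theorem ofReal_tprod_mul_setLIntegral_eq_lintegral [Countable ι] {L : ι → ℝ} (h1 : ∀ i, 1 ≤ L i)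
    (hL : Multipliable L) {G : X → ℝ≥0∞} {C : Set X} {B : Finset ι → Set X} (hB : Monotone B)
    (hBU : (⋃ F, B F) = univ)
    (h : ∀ F : Finset ι, (∏ i ∈ F, ENNReal.ofReal (L i)) * ∫⁻ x in C, G x ∂m = ∫⁻ x in B F, G x ∂m) :
    ENNReal.ofReal (∏' i, L i) * ∫⁻ x in C, G x ∂m = ∫⁻ x, G x ∂m := by
  rw [← iSup_finsetProd_ofReal_eq_ofReal_tprod h1 hL]
  exact iSup_finsetProd_mul_setLIntegral_eq_lintegral (fun i => ENNReal.ofReal (L i)) hB hBU h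

/-- The same in real numbers: under the hypotheses of `ofReal_tprod_mul_setLIntegral_eq_lintegral`,
`(∫ G dm).toReal = (∏' i, L i) · (∫_C G dm).toReal` — the identity `Ψ(σ) = L^{S₀}(σ) · A(σ)` between
the unfolded integral, the Euler product over the good places and the bad-place moment
`A(σ) = ∫_{B(Good) × K}`, in the form fed (after `I(σ) = κ₀ Ψ(σ)`) to
`JacquetShalika1981_partialPairL_pole_of_eq_conj_of_real_moment_datum`. [folklore] -/
theorem lintegral_toReal_eq_tprod_mul [Countable ι] {L : ι → ℝ} (h1 : ∀ i, 1 ≤ L i)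
    (hL : Multipliable L) {G : X → ℝ≥0∞} {C : Set X} {B : Finset ι → Set X} (hB : Monotone B)
    (hBU : (⋃ F, B F) = univ)
    (h : ∀ F : Finset ι, (∏ i ∈ F, ENNReal.ofReal (L i)) * ∫⁻ x in C, G x ∂m = ∫⁻ x in B F, G x ∂m) :
    (∫⁻ x, G x ∂m).toReal = (∏' i, L i) * (∫⁻ x in C, G x ∂m).toReal := by
  have hprod : 0 ≤ ∏' i, L i :=
    ge_of_tendsto' hL.hasProd fun F => Finset.prod_nonneg fun i _ => zero_le_one.trans (h1 i)
  rw [← ofReal_tprod_mul_setLIntegral_eq_lintegral h1 hL hB hBU h, ENNReal.toReal_mul,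
    ENNReal.toReal_ofReal hprod]

end EulerLimit

end Literature.NumberTheory.Automorphic
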